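import Literature.Algebra.Lie.Sl2Strings
import Literature.RepresentationTheory.AlgebraicGroups.SL2SymPower
import Literature.NumberTheory.Automorphic.RootData
import Mathlib.RingTheory.Nilpotent.Exp
import HarnessLib

/-!
# Integrating a finite-dimensional `sl₂`-module to `SL₂`: the action on strings

Representation theory of `SL₂` (namespace `Literature.RepresentationTheory.AlgebraicGroups.Sl2Rep`),
needed for the homomorphisms `SL₂ → G` realising the roots of the reductive group constructed in
Chevalley's existence theorem (Springer, *Linear Algebraic Groups*, 2nd ed., 7.3, 8.1.1 (i),
10.1–10.2; `Literature.NumberTheory.Automorphic.chevalley_existence`). For an `sl₂`-triple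
`(H, E, F)` of endomorphisms of a finite-dimensional `V` over an algebraically closed field of
characteristic `0` with `H` diagonalisable, `Sl2Strings.lean` provides the **string basis**
`b_τ = F^{j} w` (`w` primitive of weight `m`, `0 ≤ j ≤ m`). Here we let `g ∈ SL₂(k)` act on the
string `w, F w, …, F^m w` through the symmetric power `Sym^m (g)` (`SL2SymPower.lean`) in the
rescaled basis `u_j = ((m-j)!/m!) F^j w` (in which `E u_j = j u_{j-1}`, `F u_j = (m-j) u_{j+1}`,
the derivative of the substitution action on `X₀^{m-j} X₁^j`), and prove (everything is proved):

* bookkeeping of the strings (`strT`, `posT`, `idxT`, `sum_fiber`): the string basis index set is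
  in bijection, string by string, with the positions `0, …, m`;
* `repMat g`: the matrix of the action of `g` in the string basis, block diagonal along the
  strings with blocks conjugate to `Sym^m (g)`; **multiplicativity** (`repMat_mul`, `repMat_one`)
  and the representation `rep : SL₂(k) →* End V` (`rep_apply_stringBasis`);
* **the one-parameter subgroups integrate `E` and `F`**: `rep (u⁺(x)) = exp (x E)` and
  `rep (u⁻(x)) = exp (x F)` (`rep_unipotentUpperSL2`, `rep_unipotentLowerSL2`), by comparing, on
  `F^j w`, the binomial entries of `Sym^m` of `!![1, x; 0, 1]`, `!![1, 0; x, 1]` with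
  `E^r F^j w = (j!/(j-r)!)((m-j+r)!/(m-j)!) F^{j-r} w` (`E_pow_F_pow_apply`) and `F^r F^j w`;
* **the torus acts by the weights**: `rep (diag (a, a⁻¹)) (F^j w) = a^{m-2j} F^j w`
  (`rep_diagSL2_stringBasis`).

The matrix version (`SL₂(k) → GL n k`, algebraicity, determinant one) is in
`Sl2Exponential.lean`.

## Mathlib

`IsSl2Triple.HasPrimitiveVectorWith.lie_e_pow_succ_toEnd_f`, `Matrix.toLin`,
`Matrix.toLin_mul`, `Matrix.toLin_self`, `IsNilpotent.exp_eq_sum`, `Nat.descFactorial`,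
`Nat.cast_choose`, `Finset.sum_bij'`. Mathlib has no integration of `sl₂`-modules to `SL₂`;
nothing here duplicates a Mathlib declaration.

## References

* J. E. Humphreys, *Introduction to Lie Algebras and Representation Theory*, GTM 9 (1972), §7.2.
* T. A. Springer, *Linear Algebraic Groups*, 2nd ed. (1998), 7.3, 10.1.1 [SpringerLAG1998].
* R. Steinberg, *Lectures on Chevalley groups*, Yale (1968), §3 (Lemma 19: `x_α(t)` in a
  representation).
-/

noncomputable section

namespace Literature.RepresentationTheory.AlgebraicGroups.Sl2Rep

open Module LieModule
open Literature.Algebra.Lie.Sl2 Literature.RepresentationTheory.AlgebraicGroups.SL2Sym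
open Literature.NumberTheory.Automorphic (unipotentUpperSL2 unipotentLowerSL2 diagSL2
  coe_unipotentUpperSL2 coe_unipotentLowerSL2 coe_diagSL2)
open scoped MatrixGroups

attribute [local instance 100] LieRing.ofAssociativeRing

variable {k : Type*} [Field k]
variable {V : Type*} [AddCommGroup V] [Module k V]
variable {H E F : Module.End k V} (t : IsSl2Triple H E F) (hdiag : ⨆ μ : k, wsp H μ = ⊤)

/-! ### `E^r` on a string -/

section EPow

include t

/-- The integer coefficient `c (m, j, r) = (j!/(j-r)!) ((m-j+r)!/(m-j)!)` of
`E^r F^j w = c F^{j-r} w`. [folklore] -/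
def eCoeff (m j r : ℕ) : ℕ := j.descFactorial r * (m - j + r).descFactorial r

omit t in
/-- `c (m, j, 0) = 1`. [folklore] -/
lemma eCoeff_zero (m j : ℕ) : eCoeff m j 0 = 1 := by simp [eCoeff]

omit t in
/-- The recursion `c (m, j, r+1) = (j-r)(m-j+r+1) c (m, j, r)`. [folklore] -/
lemma eCoeff_succ (m j r : ℕ) :
    eCoeff m j (r + 1) = (j - r) * (m - j + r + 1) * eCoeff m j r := by
  rw [eCoeff, eCoeff, Nat.descFactorial_succ, show m - j + (r + 1) = (m - j + r) + 1 by omega,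
    Nat.succ_descFactorial_succ]
  ring

/-- **`E^r F^j w = c (m, j, r) F^{j-r} w`** for a primitive vector `w` of weight `m` and
`r ≤ j ≤ m` (iterate `E F^{n+1} w = (n+1)(m-n) F^n w`, Mathlib `lie_e_pow_succ_toEnd_f`).
[folklore] -/
theorem E_pow_F_pow_apply {m : ℕ} {w : V} (hw : w ∈ wsp H (m : k)) (hw0 : w ≠ 0) (hwE : E w = 0)
    {r j : ℕ} (hrj : r ≤ j) (hjm : j ≤ m) :
    (E ^ r) ((F ^ j) w) = (eCoeff m j r : k) • (F ^ (j - r)) w := by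
  have P := hasPrimitiveVectorWith t hw hw0 hwE
  induction r with
  | zero => simp [eCoeff_zero]
  | succ r ih =>
    have hr : r ≤ j := (Nat.le_succ r).trans hrj
    rw [pow_succ', Module.End.mul_apply, ih hr, map_smul]
    -- `E F^{n+1} w = (n + 1) (m - n) F^n w` with `n + 1 = j - r`
    obtain ⟨n, hn⟩ : ∃ n, j - r = n + 1 := ⟨j - r - 1, by omega⟩
    have key := P.lie_e_pow_succ_toEnd_f n
    rw [Module.End.lie_apply, toEnd_pow_apply, toEnd_pow_apply] at key
    rw [hn, key, smul_smul, show j - (r + 1) = n by omega, eCoeff_succ]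
    congr 1
    have hn' : (n : k) = j - r - 1 := by
      have h1 : ((j - r : ℕ) : k) = n + 1 := by rw [hn]; push_cast; ring
      rw [Nat.cast_sub hr] at h1
      linear_combination -h1
    push_cast [Nat.cast_sub hr, Nat.cast_sub hjm]
    rw [hn']
    ring

/-- `E^r F^j w = 0` for `j < r` (and `j ≤ m`). [folklore] -/
theorem E_pow_F_pow_apply_eq_zero {m : ℕ} {w : V} (hw : w ∈ wsp H (m : k)) (hw0 : w ≠ 0)
    (hwE : E w = 0) {r j : ℕ} (hjr : j < r) (hjm : j ≤ m) : (E ^ r) ((F ^ j) w) = 0 := by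
  obtain ⟨s, rfl⟩ : ∃ s, r = s + (j + 1) := ⟨r - (j + 1), by omega⟩
  rw [pow_add, Module.End.mul_apply, pow_succ', Module.End.mul_apply,
    E_pow_F_pow_apply t hw hw0 hwE le_rfl hjm, map_smul, Nat.sub_self, pow_zero,
    Module.End.one_apply, hwE, smul_zero, map_zero]

variable [CharZero k] [FiniteDimensional k V]

/-- `F^i w` vanishes past the end of the string (`i > m`). [folklore] -/
theorem F_pow_apply_eq_zero_of_lt {m : ℕ} {w : V} (hw : w ∈ wsp H (m : k)) (hw0 : w ≠ 0)
    (hwE : E w = 0) {i : ℕ} (hi : m < i) : (F ^ i) w = 0 := by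
  obtain ⟨s, rfl⟩ : ∃ s, i = s + (m + 1) := ⟨i - (m + 1), by omega⟩
  rw [pow_add, Module.End.mul_apply, F_pow_succ_apply_eq_zero t hw hw0 hwE, map_zero]

end EPow

/-! ### Bookkeeping of the strings -/

section Strings

variable [CharZero k] [FiniteDimensional k V]

/-- The index type of the string basis of `Sl2Strings.lean`. [folklore] -/
abbrev Idx (H E F : Module.End k V) : Type _ :=
  Σ χ : NE H E F, Fin (Module.finrank k ↥(topPiece H E F (χ.1 true)))

/-- The strings: a Casimir eigenvalue `c` and an index of the basis of the top piece
`V(c) ∩ V_m` (the head `w` of the string `w, F w, …, F^m w`). [folklore] -/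
abbrev Str (H E F : Module.End k V) : Type _ := Σ c : k, Fin (Module.finrank k ↥(topPiece H E F c))

/-- The string of an index. [folklore] -/
def strT (τ : Idx H E F) : Str H E F := ⟨τ.1.1 true, τ.2⟩

/-- The length `m` of a string (its head has weight `m`). [folklore] -/
def mOf (σ : Str H E F) : ℕ := natOf σ.1

/-- The head `w` of a string (a primitive vector of weight `m`). [folklore] -/
def headV (σ : Str H E F) : V := (topBasis (H := H) (E := E) (F := F) σ.1 σ.2 : V)

omit [CharZero k] [FiniteDimensional k V] in
/-- The Casimir eigenvalue of the string of an index. [folklore] -/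
lemma strT_fst (τ : Idx H E F) : (strT τ).1 = τ.1.1 true := rfl

omit [CharZero k] [FiniteDimensional k V] in
/-- A string has a non-zero Casimir block (its top piece contains a basis vector). [folklore] -/
lemma block_ne_bot_str (σ : Str H E F) : block H E F σ.1 ≠ ⊥ := by
  have hd : 0 < Module.finrank k ↥(topPiece H E F σ.1) := Fin.pos σ.2
  intro hb
  have htop : topPiece H E F σ.1 = ⊥ := by
    rw [eq_bot_iff]
    exact inf_le_left.trans (le_of_eq hb)
  rw [htop, finrank_bot] at hd
  exact lt_irrefl 0 hd

include t hdiag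

/-- `c = m (m + 2)` for the block of a string. [folklore] -/
lemma natOf_spec_str (σ : Str H E F) : (mOf σ : k) * mOf σ + 2 * mOf σ = σ.1 :=
  natOf_spec (exists_nat_of_block_ne_bot t hdiag (block_ne_bot_str σ))

/-- The head of a string is a primitive vector of weight `m`. [folklore] -/
lemma headV_primitive (σ : Str H E F) :
    headV σ ∈ wsp H (mOf σ : k) ∧ headV σ ≠ 0 ∧ E (headV (H := H) (E := E) (F := F) σ) = 0 := by
  have h := topBasis_primitive t hdiag σ.1 (exists_nat_of_block_ne_bot t hdiag
    (block_ne_bot_str σ)) σ.2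
  refine ⟨mem_wsp_iff.2 h.1, ?_, h.2⟩
  intro h0
  exact (topBasis (H := H) (E := E) (F := F) σ.1).ne_zero σ.2 (Subtype.ext h0)

/-- The position of an index in its string. [folklore] -/
def posT (τ : Idx H E F) : ℕ := posOf t hdiag τ.1

/-- `posT τ ≤ m`. [folklore] -/
lemma posT_le (τ : Idx H E F) : posT t hdiag τ ≤ mOf (strT τ) := posOf_le t hdiag τ.1

variable [IsAlgClosed k] [DecidableEq k]

/-- **The string basis vector of `τ` is `F ^ (posT τ)` of the head of its string.** [folklore] -/
lemma stringBasis_eq (τ : Idx H E F) :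
    stringBasis t hdiag τ = (F ^ posT t hdiag τ) (headV (strT τ)) := by
  rcases τ with ⟨χ, s⟩
  exact stringBasis_apply t hdiag χ s

omit [IsAlgClosed k] [DecidableEq k] in
/-- The index at position `j ≤ m` of the string `σ`. [folklore] -/
def idxT (σ : Str H E F) (j : ℕ) (hj : j ≤ mOf σ) : Idx H E F :=
  ⟨⟨fun b => if b then σ.1 else (mOf σ : k) - 2 * j,
    simPiece_ne_bot_of_le t hdiag (block_ne_bot_str σ) hj⟩, σ.2⟩

omit [IsAlgClosed k] [DecidableEq k] in
/-- `idxT σ j` lies in the string `σ`. [folklore] -/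
@[simp] lemma strT_idxT (σ : Str H E F) (j : ℕ) (hj : j ≤ mOf σ) :
    strT (idxT t hdiag σ j hj) = σ := rfl

omit [IsAlgClosed k] [DecidableEq k] in
/-- `idxT σ j` has position `j`. [folklore] -/
@[simp] lemma posT_idxT (σ : Str H E F) (j : ℕ) (hj : j ≤ mOf σ) :
    posT t hdiag (idxT t hdiag σ j hj) = j :=
  posOf_eq t hdiag (block_ne_bot_str σ) hj

omit [IsAlgClosed k] [DecidableEq k] in
/-- An index is the index of its string at its position. [folklore] -/
lemma idxT_strT_posT (τ : Idx H E F) :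
    idxT t hdiag (strT τ) (posT t hdiag τ) (posT_le t hdiag τ) = τ := by
  rcases τ with ⟨⟨χ, hχ⟩, s⟩
  have hfun : (fun b => if b then χ true else
      (natOf (χ true) : k) - 2 * posOf t hdiag ⟨χ, hχ⟩) = χ := by
    funext b
    cases b
    · exact (weight_eq_posOf t hdiag ⟨χ, hχ⟩).symm
    · rfl
  simp only [idxT, strT, mOf, posT]
  congr 1
  exact Subtype.ext hfun

omit [IsAlgClosed k] [DecidableEq k] in
/-- Variant of `idxT_strT_posT` with the string and the position as variables. [folklore] -/
lemma idxT_eq_of_eq {τ : Idx H E F} {σ : Str H E F} (hσ : strT τ = σ) {j : ℕ}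
    (hj : posT t hdiag τ = j) (hjm : j ≤ mOf σ) : idxT t hdiag σ j hjm = τ := by
  subst hσ; subst hj
  exact idxT_strT_posT t hdiag τ

omit [IsAlgClosed k] [DecidableEq k] in
/-- **Indices are determined by their string and position.** [folklore] -/
lemma eq_of_strT_eq_of_posT_eq {τ τ' : Idx H E F} (hs : strT τ = strT τ')
    (hp : posT t hdiag τ = posT t hdiag τ') : τ = τ' := by
  rw [← idxT_strT_posT t hdiag τ, ← idxT_eq_of_eq t hdiag hs.symm hp.symm]

omit [IsAlgClosed k] in
/-- **Sums over a string are sums over its positions `0, …, m`.** [folklore] -/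
theorem sum_fiber [Fintype (NE H E F)] {M : Type*} [AddCommMonoid M]
    (σ : Str H E F) (f : Idx H E F → M) :
    ∑ τ ∈ Finset.univ.filter (fun τ => strT τ = σ), f τ =
      ∑ j : Fin (mOf σ + 1), f (idxT t hdiag σ j (Nat.le_of_lt_succ j.2)) := by
  refine Finset.sum_bij' (fun τ _ => ⟨posT t hdiag τ, ?_⟩)
    (fun j _ => idxT t hdiag σ j (Nat.le_of_lt_succ j.2)) ?_ ?_ ?_ ?_ ?_
  · rename_i hτ
    rw [Finset.mem_filter] at hτ
    have := posT_le t hdiag τ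
    rw [hτ.2] at this
    exact Nat.lt_succ_of_le this
  · intro τ _; exact Finset.mem_univ _
  · intro j _
    rw [Finset.mem_filter]
    exact ⟨Finset.mem_univ _, strT_idxT t hdiag σ j _⟩
  · intro τ hτ
    rw [Finset.mem_filter] at hτ
    exact idxT_eq_of_eq t hdiag hτ.2 rfl _
  · intro j _
    exact Fin.ext (posT_idxT t hdiag σ j _)
  · intro τ hτ
    rw [Finset.mem_filter] at hτ
    exact congrArg f (idxT_eq_of_eq t hdiag hτ.2 rfl _).symm

end Strings

/-! ### The matrix of `g ∈ SL₂` in the string basis -/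

section Matrix

variable [CharZero k] [FiniteDimensional k V]

/-- The entry `Sym^m(g)_{ij}` with natural number indices (`0` out of range), over any
commutative ring. [folklore] -/
def symCoeff {R : Type*} [CommRing R] (m : ℕ) (g : Matrix (Fin 2) (Fin 2) R) (i j : ℕ) : R :=
  if h : i ≤ m ∧ j ≤ m then symPowerMat m g ⟨i, Nat.lt_succ_of_le h.1⟩ ⟨j, Nat.lt_succ_of_le h.2⟩
  else 0

omit [CharZero k] in
/-- `symCoeff` in range is the entry of `Sym^m`. [folklore] -/
lemma symCoeff_eq {R : Type*} [CommRing R] {m : ℕ} (g : Matrix (Fin 2) (Fin 2) R) {i j : ℕ}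
    (hi : i ≤ m) (hj : j ≤ m) :
    symCoeff m g i j = symPowerMat m g ⟨i, Nat.lt_succ_of_le hi⟩ ⟨j, Nat.lt_succ_of_le hj⟩ := by
  rw [symCoeff, dif_pos ⟨hi, hj⟩]

omit [CharZero k] in
/-- `symCoeff` out of range is `0`. [folklore] -/
lemma symCoeff_of_not {R : Type*} [CommRing R] {m : ℕ} (g : Matrix (Fin 2) (Fin 2) R) {i j : ℕ}
    (h : ¬ (i ≤ m ∧ j ≤ m)) : symCoeff m g i j = 0 := by
  rw [symCoeff, dif_neg h]

omit [CharZero k] in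
/-- `symCoeff` is multiplicative (a matrix product over the positions). [folklore] -/
lemma symCoeff_mul {m : ℕ} (g h : Matrix (Fin 2) (Fin 2) k) {i j : ℕ} (hi : i ≤ m) (hj : j ≤ m) :
    symCoeff m (g * h) i j = ∑ l : Fin (m + 1), symCoeff m g i l * symCoeff m h l j := by
  rw [symCoeff_eq _ hi hj, symPowerMat_mul, Matrix.mul_apply]
  refine Finset.sum_congr rfl fun l _ => ?_
  rw [symCoeff_eq g hi (Nat.le_of_lt_succ l.2), symCoeff_eq h (Nat.le_of_lt_succ l.2) hj]

omit [CharZero k] in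
/-- **The entries `symCoeff` are polynomial in `g`.** [folklore] -/
lemma eval_symCoeff_mvPolynomialX {m : ℕ} (g : Matrix (Fin 2) (Fin 2) k) (i j : ℕ) :
    MvPolynomial.eval (fun ab : Fin 2 × Fin 2 => g ab.1 ab.2)
      (symCoeff m (Matrix.mvPolynomialX (Fin 2) (Fin 2) k) i j) = symCoeff m g i j := by
  by_cases h : i ≤ m ∧ j ≤ m
  · rw [symCoeff_eq _ h.1 h.2, symCoeff_eq _ h.1 h.2, eval_symPowerMat_mvPolynomialX]
  · rw [symCoeff_of_not _ h, symCoeff_of_not _ h, map_zero]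

include t hdiag

/-- The rescaling `q_τ = (m - j)! / m!` of the string basis (`u_τ = q_τ b_τ`). [folklore] -/
def qT (τ : Idx H E F) : k :=
  ((mOf (strT τ) - posT t hdiag τ).factorial : k) / ((mOf (strT τ)).factorial : k)

/-- The rescaling factors are non-zero (characteristic `0`). [folklore] -/
lemma qT_ne_zero (τ : Idx H E F) : qT t hdiag τ ≠ 0 := by
  rw [qT]
  exact div_ne_zero (Nat.cast_ne_zero.2 (Nat.factorial_ne_zero _))
    (Nat.cast_ne_zero.2 (Nat.factorial_ne_zero _))

open Classical in
/-- **The matrix of `g ∈ SL₂` in the string basis**: block diagonal along the strings, with block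
`Q Sym^m (g) Q⁻¹` for the diagonal rescaling `Q = diag (q_j)`. [folklore] -/
def repMat (g : Matrix (Fin 2) (Fin 2) k) : Matrix (Idx H E F) (Idx H E F) k := fun τ τ' =>
  if strT τ = strT τ' then
    qT t hdiag τ * (qT t hdiag τ')⁻¹ * symCoeff (mOf (strT τ)) g (posT t hdiag τ) (posT t hdiag τ')
  else 0

/-- `repMat` within a string. [folklore] -/
lemma repMat_apply_of_eq (g : Matrix (Fin 2) (Fin 2) k) {τ τ' : Idx H E F} (h : strT τ = strT τ') :
    repMat t hdiag g τ τ' = qT t hdiag τ * (qT t hdiag τ')⁻¹ *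
      symCoeff (mOf (strT τ)) g (posT t hdiag τ) (posT t hdiag τ') := by
  rw [repMat, if_pos h]

/-- `repMat` vanishes between different strings. [folklore] -/
lemma repMat_apply_of_ne (g : Matrix (Fin 2) (Fin 2) k) {τ τ' : Idx H E F} (h : strT τ ≠ strT τ') :
    repMat t hdiag g τ τ' = 0 := by
  rw [repMat, if_neg h]

variable [Fintype (NE H E F)] [DecidableEq k]

/-- Sums against a column of `repMat` reduce to the string of the column index. [folklore] -/
lemma sum_repMat_mul {M : Type*} [AddCommMonoid M] [Module k M] (g : Matrix (Fin 2) (Fin 2) k)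
    (τ' : Idx H E F) (f : Idx H E F → M) :
    ∑ τ, repMat t hdiag g τ τ' • f τ =
      ∑ i : Fin (mOf (strT τ') + 1), repMat t hdiag g
        (idxT t hdiag (strT τ') i (Nat.le_of_lt_succ i.2)) τ' •
          f (idxT t hdiag (strT τ') i (Nat.le_of_lt_succ i.2)) := by
  rw [← sum_fiber t hdiag (strT τ') (fun τ => repMat t hdiag g τ τ' • f τ), Finset.sum_filter]
  refine Finset.sum_congr rfl fun τ _ => ?_
  split_ifs with h
  · rfl
  · rw [repMat_apply_of_ne t hdiag g h, zero_smul]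

/-- **`repMat` is multiplicative.** [folklore] -/
theorem repMat_mul (g h : Matrix (Fin 2) (Fin 2) k) :
    repMat t hdiag (g * h) = repMat t hdiag g * repMat t hdiag h := by
  ext τ τ''
  rw [Matrix.mul_apply]
  by_cases hs : strT τ = strT τ''
  · -- both in the string `σ`; restrict the sum to it
    have hsum : ∑ τ', repMat t hdiag g τ τ' * repMat t hdiag h τ' τ'' =
        ∑ τ' ∈ Finset.univ.filter (fun τ' => strT τ' = strT τ),
          repMat t hdiag g τ τ' * repMat t hdiag h τ' τ'' := by
      rw [Finset.sum_filter]
      refine Finset.sum_congr rfl fun τ' _ => ?_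
      split_ifs with h1
      · rfl
      · rw [repMat_apply_of_ne t hdiag g (Ne.symm h1), zero_mul]
    rw [hsum, sum_fiber t hdiag (strT τ), repMat_apply_of_eq t hdiag _ hs,
      symCoeff_mul g h (posT_le t hdiag τ) (hs ▸ posT_le t hdiag τ''), Finset.mul_sum]
    refine Finset.sum_congr rfl fun l _ => ?_
    rw [repMat_apply_of_eq t hdiag g (strT_idxT t hdiag _ _ _).symm,
      repMat_apply_of_eq t hdiag h ((strT_idxT t hdiag _ _ _).trans hs), posT_idxT,
      strT_idxT]
    have hq := qT_ne_zero t hdiag (idxT t hdiag (strT τ) l (Nat.le_of_lt_succ l.2))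
    field_simp
  · rw [repMat_apply_of_ne t hdiag _ hs]
    symm
    refine Finset.sum_eq_zero fun τ' _ => ?_
    by_cases h1 : strT τ = strT τ'
    · rw [repMat_apply_of_ne t hdiag h (fun h2 => hs (h1.trans h2)), mul_zero]
    · rw [repMat_apply_of_ne t hdiag g h1, zero_mul]

omit [Fintype (NE H E F)] in
/-- **`repMat 1 = 1`.** [folklore] -/
theorem repMat_one : repMat t hdiag (1 : Matrix (Fin 2) (Fin 2) k) = 1 := by
  ext τ τ'
  by_cases hs : strT τ = strT τ'
  · rw [repMat_apply_of_eq t hdiag _ hs, symCoeff_eq _ (posT_le t hdiag τ) (hs ▸ posT_le t hdiag τ'),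
      symPowerMat_one, Matrix.one_apply, Matrix.one_apply]
    by_cases hp : posT t hdiag τ = posT t hdiag τ'
    · have hττ' : τ = τ' := eq_of_strT_eq_of_posT_eq t hdiag hs hp
      subst hττ'
      rw [if_pos rfl, if_pos rfl, mul_one, mul_inv_cancel₀ (qT_ne_zero t hdiag τ)]
    · rw [if_neg (fun h => hp (Fin.mk.inj_iff.1 h)), mul_zero,
        if_neg (fun h => hp (congrArg (posT t hdiag) h))]
  · rw [repMat_apply_of_ne t hdiag _ hs, Matrix.one_apply,
      if_neg (fun h => hs (congrArg strT h))]

variable [IsAlgClosed k]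

/-- **The representation `SL₂(k) → End V`** integrating the `sl₂`-triple: `g` acts on the string
`w, F w, …, F^m w` through `Sym^m (g)` in the rescaled basis `((m-j)!/m!) F^j w`. [folklore] -/
def rep : SL(2, k) →* Module.End k V where
  toFun g := Matrix.toLin (stringBasis t hdiag) (stringBasis t hdiag)
    (repMat t hdiag (g : Matrix (Fin 2) (Fin 2) k))
  map_one' := by
    rw [Matrix.SpecialLinearGroup.coe_one, repMat_one]
    exact Matrix.toLin_one _
  map_mul' g h := by
    rw [Matrix.SpecialLinearGroup.coe_mul, repMat_mul,
      Matrix.toLin_mul (stringBasis t hdiag) (stringBasis t hdiag) (stringBasis t hdiag)]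
    rfl

/-- Unfolding of `rep`. [folklore] -/
lemma rep_apply (g : SL(2, k)) : rep t hdiag g = Matrix.toLin (stringBasis t hdiag)
    (stringBasis t hdiag) (repMat t hdiag (g : Matrix (Fin 2) (Fin 2) k)) := rfl

/-- **The action on the string basis.** [folklore] -/
theorem rep_apply_stringBasis (g : SL(2, k)) (τ' : Idx H E F) :
    rep t hdiag g (stringBasis t hdiag τ') =
      ∑ i : Fin (mOf (strT τ') + 1), repMat t hdiag (g : Matrix (Fin 2) (Fin 2) k)
        (idxT t hdiag (strT τ') i (Nat.le_of_lt_succ i.2)) τ' •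
          (F ^ (i : ℕ)) (headV (strT τ')) := by
  rw [rep_apply, Matrix.toLin_self, sum_repMat_mul]
  refine Finset.sum_congr rfl fun i _ => ?_
  rw [stringBasis_eq, posT_idxT, strT_idxT]

end Matrix

/-! ### Factorial arithmetic -/

section Arith

omit t

/-- `n (n-1) ⋯ (n-r+1) = n! / (n-r)!` in a field of characteristic `0`. [folklore] -/
lemma cast_descFactorial [CharZero k] {n r : ℕ} (h : r ≤ n) :
    (n.descFactorial r : k) = n.factorial / (n - r).factorial := by
  rw [eq_div_iff (Nat.cast_ne_zero.2 (Nat.factorial_ne_zero _))]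
  exact_mod_cast (mul_comm _ _).trans (Nat.factorial_mul_descFactorial h)

/-- The coefficient `c (m, j, j - i) = j! (m-i)! / (i! (m-j)!)` for `i ≤ j ≤ m`. [folklore] -/
lemma cast_eCoeff [CharZero k] {m i j : ℕ} (hij : i ≤ j) (hjm : j ≤ m) :
    (eCoeff m j (j - i) : k) =
      j.factorial * (m - i).factorial / (i.factorial * (m - j).factorial) := by
  rw [eCoeff, Nat.cast_mul, cast_descFactorial (Nat.sub_le j i),
    show m - j + (j - i) = m - i by omega, cast_descFactorial (by omega : j - i ≤ m - i),
    show j - (j - i) = i by omega, show m - i - (j - i) = m - j by omega]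
  have h1 : (i.factorial : k) ≠ 0 := Nat.cast_ne_zero.2 (Nat.factorial_ne_zero _)
  have h2 : ((m - j).factorial : k) ≠ 0 := Nat.cast_ne_zero.2 (Nat.factorial_ne_zero _)
  field_simp

end Arith

/-! ### Integrating `E`, `F` and `H`: the matrix setting -/

section Integrate

variable [CharZero k] {n : Type*} [Fintype n] [DecidableEq n]

omit t [CharZero k] in
/-- Powers of `toLin'`. [folklore] -/
lemma toLin'_pow_apply (M : Matrix n n k) (r : ℕ) (v : n → k) :
    (Matrix.toLin' M ^ r) v = (M ^ r).mulVec v := by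
  rw [show Matrix.toLin' M ^ r = Matrix.toLin' (M ^ r) from
    (map_pow (Matrix.toLinAlgEquiv' : Matrix n n k ≃ₐ[k] _) M r).symm, Matrix.toLin'_apply]

omit t in
/-- `exp (x M)` applied to a vector, as a finite sum of `(M^r v)`'s. [folklore] -/
lemma toLin'_exp_smul_apply {M : Matrix n n k} {N : ℕ} (hN : M ^ N = 0) (x : k) (v : n → k) :
    Matrix.toLin' (IsNilpotent.exp (x • M)) v =
      ∑ r ∈ Finset.range N, ((r.factorial : k)⁻¹ * x ^ r) • (Matrix.toLin' M ^ r) v := by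
  have hxN : (x • M) ^ N = 0 := by rw [smul_pow, hN, smul_zero]
  rw [IsNilpotent.exp_eq_sum hxN, map_sum, LinearMap.sum_apply]
  refine Finset.sum_congr rfl fun r _ => ?_
  rw [← Rat.cast_smul_eq_qsmul (R := k), map_smul, LinearMap.smul_apply, smul_pow, map_smul,
    LinearMap.smul_apply, toLin'_pow_apply, Matrix.toLin'_apply, smul_smul, Rat.cast_inv,
    Rat.cast_natCast]

variable {Hm Em Fm : Matrix n n k}
  (t' : IsSl2Triple (Matrix.toLin' Hm) (Matrix.toLin' Em) (Matrix.toLin' Fm))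
  (hdiag' : ⨆ μ : k, wsp (Matrix.toLin' Hm) μ = ⊤)
  [Fintype (NE (Matrix.toLin' Hm) (Matrix.toLin' Em) (Matrix.toLin' Fm))] [DecidableEq k]
  [IsAlgClosed k]

omit t
include t' hdiag'

omit [Fintype (NE (Matrix.toLin' Hm) (Matrix.toLin' Em) (Matrix.toLin' Fm))] [DecidableEq k]
  [IsAlgClosed k] in
/-- The rescaling factor at position `i` of the string `σ`. [folklore] -/
lemma qT_idxT (σ : Str (Matrix.toLin' Hm) (Matrix.toLin' Em) (Matrix.toLin' Fm)) (i : ℕ)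
    (hi : i ≤ mOf σ) :
    qT t' hdiag' (idxT t' hdiag' σ i hi) = ((mOf σ - i).factorial : k) / (mOf σ).factorial := by
  simp [qT, strT_idxT, posT_idxT]

/-- **The upper unipotent elements integrate `E`**: `rep (!![1, x; 0, 1]) = exp (x E)`
(comparison of the binomial entries of `Sym^m (!![1, x; 0, 1])` with `E^r F^j w`).
[folklore] -/
theorem rep_unipotentUpperSL2 (hE : IsNilpotent Em) (x : k) :
    rep t' hdiag' (unipotentUpperSL2 (Multiplicative.ofAdd x)) =
      Matrix.toLin' (IsNilpotent.exp (x • Em)) := by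
  refine (stringBasis t' hdiag').ext fun τ' => ?_
  rw [rep_apply_stringBasis, coe_unipotentUpperSL2, toAdd_ofAdd, stringBasis_eq]
  set σ := strT τ' with hσ
  set m := mOf σ with hm
  set j := posT t' hdiag' τ' with hj
  set w := headV (H := Matrix.toLin' Hm) (E := Matrix.toLin' Em) (F := Matrix.toLin' Fm) σ with hw'
  obtain ⟨hw, hw0, hwE⟩ := headV_primitive t' hdiag' σ
  have hjm : j ≤ m := posT_le t' hdiag' τ'
  -- the common value
  let c : ℕ → k := fun i =>
    x ^ (j - i) * (j.factorial * (m - i).factorial) / (((j - i).factorial * i.factorial) * (m - j).factorial)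
  have hfac : ∀ a : ℕ, (a.factorial : k) ≠ 0 := fun a => Nat.cast_ne_zero.2 (Nat.factorial_ne_zero _)
  -- LHS
  have hL : ∑ i : Fin (m + 1), repMat t' hdiag' !![1, x; 0, 1]
      (idxT t' hdiag' σ i (Nat.le_of_lt_succ i.2)) τ' • (Matrix.toLin' Fm ^ (i : ℕ)) w =
      ∑ i ∈ Finset.range (j + 1), c i • (Matrix.toLin' Fm ^ i) w := by
    have hterm : ∀ i : Fin (m + 1), repMat t' hdiag' !![1, x; 0, 1]
        (idxT t' hdiag' σ i (Nat.le_of_lt_succ i.2)) τ' = if (i : ℕ) ≤ j then c i else 0 := by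
      intro i
      rw [repMat_apply_of_eq t' hdiag' _ (strT_idxT t' hdiag' σ i _), qT_idxT, strT_idxT,
        posT_idxT, symCoeff_eq _ (Nat.le_of_lt_succ i.2) hjm, symPowerMat_upper]
      change _ * (((m - j).factorial : k) / m.factorial)⁻¹ * _ = _
      simp only [← hm]
      split_ifs with hij
      · simp only [c]
        rw [Nat.cast_choose k hij]
        have := hfac m; have := hfac (m - i); have := hfac (m - j); have := hfac i
        have := hfac (j - i); have := hfac j
        field_simp
      · rw [mul_zero]
    simp_rw [hterm]
    rw [Fin.sum_univ_eq_sum_range (fun i => (if i ≤ j then c i else 0) •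
      (Matrix.toLin' Fm ^ i) w) (m + 1)]
    rw [← Finset.sum_subset (Finset.range_subset_range.2 (Nat.succ_le_succ hjm))]
    · refine Finset.sum_congr rfl fun i hi => ?_
      rw [if_pos (Nat.le_of_lt_succ (Finset.mem_range.1 hi))]
    · intro i _ hi
      rw [if_neg (fun h => hi (Finset.mem_range.2 (Nat.lt_succ_of_le h))), zero_smul]
  -- RHS
  have hR : Matrix.toLin' (IsNilpotent.exp (x • Em)) ((Matrix.toLin' Fm ^ j) w) =
      ∑ i ∈ Finset.range (j + 1), c i • (Matrix.toLin' Fm ^ i) w := by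
    obtain ⟨N, hN⟩ := hE
    have hN' : Em ^ (N + (j + 1)) = 0 := by rw [pow_add, hN, zero_mul]
    rw [toLin'_exp_smul_apply hN',
      ← Finset.sum_subset (Finset.range_subset_range.2 (Nat.le_add_left (j + 1) N))]
    · rw [← Finset.sum_range_reflect]
      refine Finset.sum_congr rfl fun i hi => ?_
      have hij : i ≤ j := Nat.le_of_lt_succ (Finset.mem_range.1 hi)
      rw [show j + 1 - 1 - i = j - i by omega,
        E_pow_F_pow_apply t' hw hw0 hwE (Nat.sub_le j i) hjm, smul_smul,
        show j - (j - i) = i by omega, cast_eCoeff hij hjm]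
      congr 1
      simp only [c]
      have := hfac (j - i); have := hfac i; have := hfac (m - j)
      field_simp
    · intro r _ hr
      have hjr : j < r := by
        by_contra h
        exact hr (Finset.mem_range.2 (Nat.lt_succ_of_le (not_lt.1 h)))
      rw [E_pow_F_pow_apply_eq_zero t' hw hw0 hwE hjr hjm, smul_zero]
  rw [hL, hR]

/-- **The lower unipotent elements integrate `F`**: `rep (!![1, 0; x, 1]) = exp (x F)`.
[folklore] -/
theorem rep_unipotentLowerSL2 (hF : IsNilpotent Fm) (x : k) :
    rep t' hdiag' (unipotentLowerSL2 (Multiplicative.ofAdd x)) =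
      Matrix.toLin' (IsNilpotent.exp (x • Fm)) := by
  refine (stringBasis t' hdiag').ext fun τ' => ?_
  rw [rep_apply_stringBasis, coe_unipotentLowerSL2, toAdd_ofAdd, stringBasis_eq]
  set σ := strT τ' with hσ
  set m := mOf σ with hm
  set j := posT t' hdiag' τ' with hj
  set w := headV (H := Matrix.toLin' Hm) (E := Matrix.toLin' Em) (F := Matrix.toLin' Fm) σ with hw'
  obtain ⟨hw, hw0, hwE⟩ := headV_primitive t' hdiag' σ
  have hjm : j ≤ m := posT_le t' hdiag' τ'
  have hfac : ∀ a : ℕ, (a.factorial : k) ≠ 0 := fun a => Nat.cast_ne_zero.2 (Nat.factorial_ne_zero _)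
  -- the common value
  let d : ℕ → k := fun i => ((i - j).factorial : k)⁻¹ * x ^ (i - j)
  have hmid : ∑ i ∈ Finset.Ico j (m + 1), d i • (Matrix.toLin' Fm ^ i) w =
      ∑ i ∈ Finset.range (m + 1), (if j ≤ i then d i else 0) • (Matrix.toLin' Fm ^ i) w := by
    rw [Finset.range_eq_Ico, ← Finset.sum_Ico_consecutive _ (Nat.zero_le j)
      (by omega : j ≤ m + 1)]
    rw [Finset.sum_eq_zero (s := Finset.Ico 0 j), zero_add]
    · refine Finset.sum_congr rfl fun i hi => ?_
      rw [if_pos (Finset.mem_Ico.1 hi).1]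
    · intro i hi
      rw [if_neg (not_le.2 (Finset.mem_Ico.1 hi).2), zero_smul]
  -- LHS
  have hL : ∑ i : Fin (m + 1), repMat t' hdiag' !![1, 0; x, 1]
      (idxT t' hdiag' σ i (Nat.le_of_lt_succ i.2)) τ' • (Matrix.toLin' Fm ^ (i : ℕ)) w =
      ∑ i ∈ Finset.range (m + 1), (if j ≤ i then d i else 0) • (Matrix.toLin' Fm ^ i) w := by
    have hterm : ∀ i : Fin (m + 1), repMat t' hdiag' !![1, 0; x, 1]
        (idxT t' hdiag' σ i (Nat.le_of_lt_succ i.2)) τ' = if j ≤ (i : ℕ) then d i else 0 := by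
      intro i
      rw [repMat_apply_of_eq t' hdiag' _ (strT_idxT t' hdiag' σ i _), qT_idxT, strT_idxT,
        posT_idxT, symCoeff_eq _ (Nat.le_of_lt_succ i.2) hjm, symPowerMat_lower]
      change _ * (((m - j).factorial : k) / m.factorial)⁻¹ * _ = _
      simp only [← hm]
      split_ifs with hij
      · simp only [d]
        have him : (i : ℕ) ≤ m := Nat.le_of_lt_succ i.2
        rw [Nat.cast_choose k (by omega : (i : ℕ) - j ≤ m - j),
          show m - j - ((i : ℕ) - j) = m - i by omega]
        have := hfac m; have := hfac (m - i); have := hfac (m - j); have := hfac ((i : ℕ) - j)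
        field_simp
      · rw [mul_zero]
    simp_rw [hterm]
    exact Fin.sum_univ_eq_sum_range (fun i => (if j ≤ i then d i else 0) •
      (Matrix.toLin' Fm ^ i) w) (m + 1)
  -- RHS
  have hR : Matrix.toLin' (IsNilpotent.exp (x • Fm)) ((Matrix.toLin' Fm ^ j) w) =
      ∑ i ∈ Finset.Ico j (m + 1), d i • (Matrix.toLin' Fm ^ i) w := by
    obtain ⟨N, hN⟩ := hF
    have hN' : Fm ^ (N + (m + 1 - j)) = 0 := by rw [pow_add, hN, zero_mul]
    rw [toLin'_exp_smul_apply hN',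
      ← Finset.sum_subset (Finset.range_subset_range.2 (Nat.le_add_left (m + 1 - j) N)),
      Finset.sum_Ico_eq_sum_range]
    · refine Finset.sum_congr rfl fun r _ => ?_
      rw [← Module.End.mul_apply, ← pow_add, add_comm j r]
      simp only [d, Nat.add_sub_cancel]
    · intro r _ hr
      have hrm : m < r + j := by
        by_contra h
        exact hr (Finset.mem_range.2 (by omega))
      rw [← Module.End.mul_apply, ← pow_add,
        F_pow_apply_eq_zero_of_lt t' hw hw0 hwE hrm, smul_zero]
  rw [hL, hR, hmid]

omit t' hdiag' [CharZero k] [Fintype n] [DecidableEq n]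
  [Fintype (NE (Matrix.toLin' Hm) (Matrix.toLin' Em) (Matrix.toLin' Fm))] [DecidableEq k]
  [IsAlgClosed k] in
/-- The diagonal matrix of `SL₂` as `Matrix.diagonal`. [folklore] -/
lemma coe_diagSL2_eq_diagonal (a : kˣ) :
    ((diagSL2 a : SL(2, k)) : Matrix (Fin 2) (Fin 2) k) = Matrix.diagonal ![(a : k), ((a⁻¹ : kˣ) : k)] := by
  rw [coe_diagSL2]
  ext i j
  fin_cases i <;> fin_cases j <;> simp

/-- **The torus acts on the string basis by the weights**: `rep (diag (a, a⁻¹)) (F^j w) =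
a^{m-j} (a⁻¹)^j F^j w`. [folklore] -/
theorem rep_diagSL2_stringBasis (a : kˣ)
    (τ : Idx (Matrix.toLin' Hm) (Matrix.toLin' Em) (Matrix.toLin' Fm)) :
    rep t' hdiag' (diagSL2 a) (stringBasis t' hdiag' τ) =
      ((a : k) ^ (mOf (strT τ) - posT t' hdiag' τ) * ((a⁻¹ : kˣ) : k) ^ posT t' hdiag' τ) •
        stringBasis t' hdiag' τ := by
  rw [rep_apply_stringBasis, coe_diagSL2_eq_diagonal, stringBasis_eq]
  have hjm := posT_le t' hdiag' τ
  rw [Finset.sum_eq_single ⟨posT t' hdiag' τ, Nat.lt_succ_of_le hjm⟩]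
  · change repMat t' hdiag' _ (idxT t' hdiag' (strT τ) (posT t' hdiag' τ) hjm) τ • _ = _
    rw [idxT_eq_of_eq t' hdiag' rfl rfl hjm, repMat_apply_of_eq t' hdiag' _ rfl,
      symCoeff_eq _ hjm hjm, symPowerMat_diagonal, if_pos rfl,
      mul_inv_cancel₀ (qT_ne_zero t' hdiag' τ), one_mul]
  · intro i _ hi
    rw [repMat_apply_of_eq t' hdiag' _ (strT_idxT t' hdiag' _ _ _), strT_idxT, posT_idxT,
      symCoeff_eq _ (Nat.le_of_lt_succ i.2) hjm, symPowerMat_diagonal,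
      if_neg (fun h => hi (Fin.ext (Fin.mk.inj_iff.1 h))), mul_zero, zero_smul]
  · intro h; exact (h (Finset.mem_univ _)).elim

end Integrate

end Literature.RepresentationTheory.AlgebraicGroups.Sl2Rep
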